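import Mathlib
import Summits.NavierStokesRegularity.FluidComputer.AbcClassIISynthesis
import Summits.NavierStokesRegularity.FluidComputer.AbcLinearisedPairing

/-!
# Class-II layer of the skew-cut X0 chain, Part E: energy identity and bound on a Galerkin section
(instab4 g6 — implementation 2 of the skew-cut X0 certifier, cell `ns-blowup`, 2026-08-27)

HONEST FRAMING (human ruling D-0035): nothing here is a claim about Navier–Stokes blow-up.
WHAT THIS IS NOT: not NS evidence. MODEL lane. First half of residue (A1) of `AbcClassIIX0`
(deriving the uniform graph bound of the section eigenvectors from the eigen-equation alone):

* `sum_inner_section_lerayCrossForm` — the quadratic form of `Π X` on a section combination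
  `ṽ = Σ_{j ∈ cubeIdx n} v_j bfam j`, in coordinates: `Σ_k ⟪ṽ k, Π_k X ṽ k⟫ = Σ_i conj(v_i) Σ_j amat i j v_j`;
* `sum_norm_sq_section` — Parseval `Σ_k ‖ṽ k‖² = Σ_j |v_j|²`;
* `energy_bound_section` — **ENERGY**: a real eigenvector `v` of the section matrix
  `−(|O|²/R)δ + amat` with eigenvalue `x` has `Σ_i (x + |O_i|²/R) v_i² ≤ √2 Σ_i v_i²`
  (SKEWCUT-CERT §3 STEP 1; `AbcLatticePairingBound.abs_re_sum_inner_crossForm_le` +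
  `AbcLinearisedPairing.inner_lerayCoeff_of_transversal`).

What remains of (A1): Bessel per orbit + the `ℓ²` growth of `Π X` (`AbcClassIIIndex.norm_lerayCrossForm_le`)
⇒ `Σ_i (x + |O_i|²/R)² v_i² ≤ 2916 Σ_j (1 + |O_j|²) v_j²`, then the graph bound of
`AbcClassIIX0.isLinNSEigenvalue_of_section_eigenpairs` with `C² = 2(1−x)² + 5832(1 + R(√2 − x))`.
Mathlib + the files named; no new definitions.
-/

noncomputable section

open scoped BigOperators ComplexConjugate InnerProductSpace
open Finset MeasureTheory UnitAddTorus

namespace Summit.NavierStokesRegularity.FluidComputer.AbcClassII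

open Literature.Analysis.FunctionSpaces Literature.Analysis.FunctionSpaces.Torus
open Literature.Analysis.FunctionSpaces.EuclideanSpace
open Literature.Analysis.FluidPDE Literature.Analysis.FluidPDE.SteadyLattice
open Literature.Analysis.FluidPDE.ScalarFourier

/-! ## Part E. The Galerkin energy identity and bound on a section (instab4 g6) -/

section Energy

/-- Orbits of `cubeIdx n` lie in the punctured cube `n`. -/
theorem orbit_subset_cube_filter {n : ℕ} {i : Idx} (hi : i ∈ cubeIdx n) :
    i.1.1 ⊆ (cube n).filter (fun k => k ≠ 0) := by
  intro k hk
  rw [Finset.mem_filter]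
  refine ⟨mem_cube_iff_supNorm.mpr ?_, i.1.ne_zero_of_mem hk⟩
  rw [i.1.supNorm_eq hk]; exact mem_cubeIdx.mp hi

/-- A section combination vanishes off the punctured cube. -/
theorem sectionFam_eq_zero_of_not_mem {n : ℕ} (v : Idx → ℂ) {k : Fin 3 → ℤ}
    (hk : k ∉ (cube n).filter (fun k => k ≠ 0)) : (∑ j ∈ cubeIdx n, v j • bfam j) k = 0 :=
  sum_smul_bfam_apply_eq_zero (cubeIdx n) (fun j => j) v fun _ hj hkj => hk (orbit_subset_cube_filter hj hkj)

/-- **Pairing of a section combination against its basis family**: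
`Σ_{k ∈ O_i} ⟪bfam i k, Π_k X(Σ_j v_j bfam j)(k)⟫ = Σ_j amat i j · v_j`. -/
theorem sum_inner_bfam_lerayCrossForm_section (T : Finset Idx) (v : Idx → ℂ) (i : Idx) :
    ∑ k ∈ i.1.1, (inner ℂ (bfam i k) (Torus.lerayCoeff k (crossForm 1 1 1 (∑ j ∈ T, v j • bfam j) k)) : ℂ) =
      ∑ j ∈ T, ((amat i j : ℝ) : ℂ) * v j := by
  have e : ∀ k, (inner ℂ (bfam i k) (Torus.lerayCoeff k (crossForm 1 1 1 (∑ j ∈ T, v j • bfam j) k)) : ℂ) =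
      ∑ j ∈ T, v j * (inner ℂ (bfam i k) (Torus.lerayCoeff k (crossForm 1 1 1 (bfam j) k)) : ℂ) := by
    intro k
    have hL := lerayCrossForm_sum_smul T (fun j => j) v k
    rw [hL, inner_sum]
    exact Finset.sum_congr rfl fun j _ => by rw [inner_smul_right]
  rw [Finset.sum_congr rfl fun k _ => e k, Finset.sum_comm]
  refine Finset.sum_congr rfl fun j _ => ?_
  rw [← Finset.mul_sum, ← amat_eq i j, mul_comm]

/-- **The quadratic form of `Π X` on a section combination, in coordinates**:
`Σ_{k ∈ cube n∖0} ⟪ṽ k, Π_k X ṽ k⟫ = Σ_{i} conj(v_i) Σ_j amat i j v_j` for `ṽ = Σ_{j ∈ cubeIdx n} v_j bfam j`. -/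
theorem sum_inner_section_lerayCrossForm (n : ℕ) (v : Idx → ℂ) :
    ∑ k ∈ (cube n).filter (fun k => k ≠ 0),
      (inner ℂ ((∑ j ∈ cubeIdx n, v j • bfam j) k)
        (Torus.lerayCoeff k (crossForm 1 1 1 (∑ j ∈ cubeIdx n, v j • bfam j) k)) : ℂ) =
      ∑ i ∈ cubeIdx n, (starRingEnd ℂ) (v i) * ∑ j ∈ cubeIdx n, ((amat i j : ℝ) : ℂ) * v j := by
  set S := (cube n).filter (fun k => k ≠ 0) with hS
  set g : Fam := fun k => Torus.lerayCoeff k (crossForm 1 1 1 (∑ j ∈ cubeIdx n, v j • bfam j) k) with hg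
  have e1 : ∀ k, (inner ℂ ((∑ j ∈ cubeIdx n, v j • bfam j) k) (g k) : ℂ) =
      ∑ i ∈ cubeIdx n, (starRingEnd ℂ) (v i) * (inner ℂ (bfam i k) (g k) : ℂ) := by
    intro k
    rw [sum_smul_bfam_apply (cubeIdx n) (fun j => j) v k, sum_inner]
    exact Finset.sum_congr rfl fun i _ => by rw [inner_smul_left]
  change ∑ k ∈ S, (inner ℂ ((∑ j ∈ cubeIdx n, v j • bfam j) k) (g k) : ℂ) = _
  rw [Finset.sum_congr rfl fun k _ => e1 k, Finset.sum_comm]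
  refine Finset.sum_congr rfl fun i hi => ?_
  rw [← Finset.mul_sum]
  congr 1
  -- reduce the sum over the punctured cube to the orbit of `i`
  rw [← Finset.sum_subset (orbit_subset_cube_filter hi) (fun k _ hk => by
    rw [bfam_apply_of_not_mem i hk, inner_zero_left])]
  exact sum_inner_bfam_lerayCrossForm_section (cubeIdx n) v i

/-- **Parseval for a section combination**: `Σ_{k ∈ cube n∖0} ‖ṽ k‖² = Σ_{j ∈ cubeIdx n} ‖v_j‖²`. -/
theorem sum_norm_sq_section (n : ℕ) (v : Idx → ℂ) :
    ∑ k ∈ (cube n).filter (fun k => k ≠ 0), ‖(∑ j ∈ cubeIdx n, v j • bfam j) k‖ ^ 2 =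
      ∑ j ∈ cubeIdx n, ‖v j‖ ^ 2 := by
  rw [sum_cube_filter_eq, sum_cubeIdx_eq n (fun j => ‖v j‖ ^ 2)]
  refine Finset.sum_congr rfl fun O hO => ?_
  rw [← sum_norm_sq_orbitExpansion O v]
  refine Finset.sum_congr rfl fun k hk => ?_
  congr 2
  -- on the orbit `O` the section combination is its `O`-part
  rw [sum_smul_bfam_apply (cubeIdx n) (fun j => j) v k, Finset.sum_apply]
  have e : (∑ j ∈ cubeIdx n, v j • bfam j k) =
      ∑ O' ∈ cubeOrbits n, ∑ a : Fin (odim O'), v ⟨O', a⟩ • bfam ⟨O', a⟩ k :=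
    Finset.sum_sigma (cubeOrbits n) (fun O' => (Finset.univ : Finset (Fin (odim O')))) (fun j => v j • bfam j k)
  rw [e, Finset.sum_eq_single O]
  · rfl
  · intro O' _ hne
    refine Finset.sum_eq_zero fun a _ => ?_
    have hnot : k ∉ O'.1 := fun h => hne (Subtype.ext ((O'.sgnOrbit_eq h).symm.trans (O.sgnOrbit_eq hk)))
    rw [bfam_apply_of_not_mem ⟨O', a⟩ hnot, smul_zero]
  · intro hnot; exact absurd hO hnot

/-- **ENERGY BOUND for a real Galerkin eigenvector** (SKEWCUT-CERT §3 STEP 1 on a section, from the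
(A4) pairing bound `AbcLatticePairingBound.abs_re_sum_inner_crossForm_le`): if `v` is a real eigenvector
of the section matrix `−(|O|²/R)δ + amat` on `cubeIdx n` with eigenvalue `x`, then
`Σ_i (x + |O_i|²/R) v_i² ≤ √2 · Σ_i v_i²`. -/
theorem energy_bound_section {R : ℝ} (n : ℕ) (v : Idx → ℝ) (x : ℝ)
    (heig : ∀ i ∈ cubeIdx n, -(onormSq i.1 / R) * v i + ∑ j ∈ cubeIdx n, amat i j * v j = x * v i) :
    ∑ i ∈ cubeIdx n, (x + onormSq i.1 / R) * v i ^ 2 ≤ Real.sqrt 2 * ∑ i ∈ cubeIdx n, v i ^ 2 := by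
  classical
  set vc : Idx → ℂ := fun i => ((v i : ℝ) : ℂ) with hvc
  set c : Fam := ∑ j ∈ cubeIdx n, vc j • bfam j with hc
  set S := (cube n).filter (fun k => k ≠ 0) with hS
  have hct : ∀ k : Fin 3 → ℤ, ∑ jj : Fin 3, ((k jj : ℤ) : ℂ) * c k jj = 0 :=
    fun k => kdot_sum_smul_bfam (cubeIdx n) (fun j => j) vc k
  have hcS : ∀ k ∉ S, c k = 0 := fun k hk => sectionFam_eq_zero_of_not_mem vc hk
  -- the pairing bound (with the projector removed by transversality)
  have hpair := AbcLatticePairingBound.abs_re_sum_inner_crossForm_le c S hcS hct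
  have hproj : ∀ k ∈ S, (inner ℂ (c k) (crossForm 1 1 1 c k) : ℂ) =
      (inner ℂ (c k) (Torus.lerayCoeff k (crossForm 1 1 1 c k)) : ℂ) := by
    intro k hk
    rw [AbcLinearisedPairing.inner_lerayCoeff_of_transversal (Finset.mem_filter.mp hk).2 (hct k)]
  have hform : (∑ k ∈ S, (inner ℂ (c k) (Torus.lerayCoeff k (crossForm 1 1 1 c k)) : ℂ)) =
      (((∑ i ∈ cubeIdx n, (x + onormSq i.1 / R) * v i ^ 2 : ℝ)) : ℂ) := by
    rw [hS, hc, sum_inner_section_lerayCrossForm n vc]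
    push_cast
    refine Finset.sum_congr rfl fun i hi => ?_
    have h := congrArg (fun r : ℝ => (r : ℂ)) (heig i hi)
    push_cast at h
    simp only [hvc, Complex.conj_ofReal]
    linear_combination ((v i : ℝ) : ℂ) * h
  have hre : (∑ k ∈ S, (inner ℂ (c k) (crossForm 1 1 1 c k) : ℂ)).re =
      ∑ i ∈ cubeIdx n, (x + onormSq i.1 / R) * v i ^ 2 := by
    rw [Finset.sum_congr rfl hproj, hform, Complex.ofReal_re]
  have hnorm : ∑ k ∈ S, ‖c k‖ ^ 2 = ∑ i ∈ cubeIdx n, v i ^ 2 := by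
    rw [hS, hc, sum_norm_sq_section n vc]
    refine Finset.sum_congr rfl fun i _ => ?_
    simp only [hvc, Complex.norm_real, Real.norm_eq_abs, sq_abs]
  have h := (le_abs_self _).trans hpair
  change (∑ k ∈ S, (inner ℂ (c k) (crossForm 1 1 1 c k) : ℂ)).re ≤ Real.sqrt 2 * ∑ k ∈ S, ‖c k‖ ^ 2 at h
  rw [hre, hnorm] at h
  exact h

end Energy

end Summit.NavierStokesRegularity.FluidComputer.AbcClassII

end
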